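import Literature.AlgebraicGeometry.Resolution.BlowupChartRsop
import Literature.AlgebraicGeometry.Resolution.BlowupChartClosureQuotient
import Literature.AlgebraicGeometry.Resolution.LocalBlowup
import Literature.AlgebraicGeometry.Resolution.SymbolicPowersRsop
import HarnessLib

/-!
# The chart of a local blowing up along a regular centre: fractions `c_j / c_i` of the centre's regular parameters
# are part of a regular system of parameters of the new local ring

OURS (campaign res-hironaka, rung L ★L-G4, slot W4.1, crux `Steer` stmt-ResolutionOfSingularities-16345; res-L0-w41-plan-1
RULING 42 (A2) «run-threading» := res-L0-w41-stub-3 g6, brick (B2a); replaces the role of no printed item; NOT a statement of the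
manuscript under review [claim: Hironaka2017, status: under-review]; AI review is weaker than expert review). Theses-free, def-free.

For a regular local subring `R ⊆ K` dominated by a valuation ring `O`, a centre `P = (c_1, …, c_r)` generated by part `c` of a
regular system of parameters, the chart ring `C = R[c_j/c_i : j] ⊆ K` of a generator `c_i ≠ 0` of maximal value and the local
blowing up `R' = C_{𝔪_O ∩ C}` (`locAtCentre C O`):
* `closure_chartQuotient_X` — the tree's `closure_chartQuotient` (`C/(c_i) ≅ (R/P)[T_j : j ≠ i]`, Stacks 0BIQ) with the extra
  clause `T_j ↦ [c_j/c_i]` exported (proof adapted verbatim from `Literature/…/BlowupChartClosureQuotient.lean`);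
* `isRsopPart_chartFamily_closure` — the tree's ABSTRACT-CHART theorem `isRsopPart_chartFamily` (`BlowupChartRsop.lean`, de Jong
  2.4) instantiated on `(C, R ↪ C, c_j/c_i, R')`: for indices `j ≠ i` with `c_j/c_i` in the centre, `(c_i, (c_j/c_i)_j, w)` is part
  of a regular system of parameters of `R'`;
* `isRsopPart_pair_chart` — in particular two such fractions `c_{j₁}/c_i, c_{j₂}/c_i` form a part of a regular system of
  parameters of `R'` (what the critical-surface THREAD of the LOW tower consumes: `(e₁/x, e₂/x)` at the next stage).
[cite: DeJong1996, 2.4] [cite: StacksProject, Tag 0BIQ] [cite: Matsumura1987, Thm. 14.2]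
-/

noncomputable section

-- single-problem summit: the doubled namespace component `ResolutionOfSingularities` is forced
set_option linter.dupNamespace false

namespace Summit.ResolutionOfSingularities.ResolutionOfSingularities.Theorems.SwitchingDichotomy.ChartRsop

open IsLocalRing
open Literature.AlgebraicGeometry.Resolution

universe u

variable {K : Type u} [Field K]

/-- `S ≤ S[I/x_i]`. [folklore] -/
theorem le_closure_chart (S : Subring K) {r : ℕ} (x : Fin r → S) (i : Fin r) :
    S ≤ Subring.closure ((S : Set K) ∪ Set.range fun j => ((x j : S) : K) / ((x i : S) : K)) :=
  fun _ hz => Subring.subset_closure (Or.inl hz)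

/-- `x_j/x_i ∈ S[I/x_i]`. [folklore] -/
theorem div_mem_closure_chart (S : Subring K) {r : ℕ} (x : Fin r → S) (i j : Fin r) :
    ((x j : S) : K) / ((x i : S) : K) ∈
      Subring.closure ((S : Set K) ∪ Set.range fun j => ((x j : S) : K) / ((x i : S) : K)) :=
  Subring.subset_closure (Or.inr ⟨j, rfl⟩)

/-! ## §1 The exceptional fibre of the chart, with the images of the variables -/

/-- **`S[I/x_i]/(x_i) ≅ (S/I)[T_j : j ≠ i]`, with `T_j ↦ x_j/x_i`** — the tree's `closure_chartQuotient` (Stacks 0BIQ via the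
quasi-regular presentation of the affine blow-up algebra) with the images of the variables recorded. Proof adapted verbatim from
`Literature/AlgebraicGeometry/Resolution/BlowupChartClosureQuotient.lean`. [cite: StacksProject, Tag 0BIQ] -/
theorem closure_chartQuotient_X (S : Subring K) {r : ℕ} (x : Fin r → S) (hqr : IsQuasiRegular x) (i : Fin r)
    (hxi : x i ≠ 0) :
    ∃ ψ : MvPolynomial {j : Fin r // j ≠ i} (S ⧸ Ideal.span (Set.range x)) →+*
        Subring.closure ((S : Set K) ∪ Set.range fun j => ((x j : S) : K) / ((x i : S) : K)) ⧸
          Ideal.span {(⟨(x i : K), le_closure_chart S x i (x i).2⟩ :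
            Subring.closure ((S : Set K) ∪ Set.range fun j => ((x j : S) : K) / ((x i : S) : K)))},
      Function.Bijective ψ ∧
      (∀ s : S, ψ (MvPolynomial.C (Ideal.Quotient.mk _ s)) =
        Ideal.Quotient.mk _ ⟨(s : K), le_closure_chart S x i s.2⟩) ∧
      ∀ j : {j : Fin r // j ≠ i}, ψ (MvPolynomial.X j) =
        Ideal.Quotient.mk _ ⟨((x j.1 : S) : K) / ((x i : S) : K), div_mem_closure_chart S x i j.1⟩ := by
  -- adapted from `blowupRing_chartQuotient` (BlowupRingExceptionalFibre.lean), `𝔪_S ↦ I`, `κ(S) ↦ S/I`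
  classical
  set C := Subring.closure ((S : Set K) ∪ Set.range fun j => ((x j : S) : K) / ((x i : S) : K)) with hCdef
  have hSC : S ≤ C := le_closure_chart S x i
  have hθ : ((x i : S) : K) ≠ 0 := fun h => hxi (Subtype.ext h)
  have hunit : IsUnit (S.subtype (x i)) := isUnit_iff_ne_zero.mpr hθ
  -- `Θ : S[1/x_i] → K` and `g : blowupAlgebra → K`
  let Θ : Localization.Away (x i) →+* K := IsLocalization.Away.lift (x i) hunit
  have hΘalg : ∀ s : S, Θ (algebraMap S (Localization.Away (x i)) s) = (s : K) := fun s =>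
    IsLocalization.Away.lift_eq (x i) hunit s
  have hΘinv : Θ (IsLocalization.Away.invSelf (x i)) = ((x i : S) : K)⁻¹ := by
    apply eq_inv_of_mul_eq_one_left
    rw [← hΘalg (x i), ← map_mul, mul_comm, IsLocalization.Away.mul_invSelf, map_one]
  let g : blowupAlgebra (Ideal.span (Set.range x)) (x i) →+* K :=
    Θ.comp (blowupAlgebra (Ideal.span (Set.range x)) (x i)).val.toRingHom
  have hgalg : ∀ s : S, g (algebraMap S (blowupAlgebra (Ideal.span (Set.range x)) (x i)) s) = (s : K) :=
    fun s => hΘalg s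
  have hgfrac : ∀ j : Fin r, g (blowupAlgebra.frac x i j) = ((x j : S) : K) / ((x i : S) : K) := by
    intro j
    change Θ ((blowupAlgebra.frac x i j : Localization.Away (x i))) = _
    rw [blowupAlgebra.coe_frac, map_mul, hΘalg, hΘinv, div_eq_mul_inv]
  -- `g ∘ eval = eval₂ (x_j/x_i)`
  have hgeval : g.comp (blowupAlgebra.eval x i).toRingHom =
      MvPolynomial.eval₂Hom S.subtype
        (fun j : {j : Fin r // j ≠ i} => ((x j.1 : S) : K) / ((x i : S) : K)) := by
    refine (blowupAlgebra.comp_val_comp_eval x i Θ).trans ?_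
    congr 1
    · ext s
      exact hΘalg s
    · funext j
      exact hgfrac j.1
  have hgeval' : ∀ P, g (blowupAlgebra.eval x i P) = MvPolynomial.eval₂Hom S.subtype
      (fun j : {j : Fin r // j ≠ i} => ((x j.1 : S) : K) / ((x i : S) : K)) P := fun P => by
    rw [← hgeval]; rfl
  -- the range of `g` is `C`
  have heval_mem : ∀ P : MvPolynomial {j : Fin r // j ≠ i} S, MvPolynomial.eval₂Hom S.subtype
      (fun j : {j : Fin r // j ≠ i} => ((x j.1 : S) : K) / ((x i : S) : K)) P ∈ C := by
    intro P
    induction P using MvPolynomial.induction_on with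
    | C s =>
      rw [MvPolynomial.eval₂Hom_C]
      exact hSC s.2
    | add p q hp hq =>
      rw [map_add]
      exact Subring.add_mem _ hp hq
    | mul_X p j hp =>
      rw [map_mul, MvPolynomial.eval₂Hom_X']
      exact Subring.mul_mem _ hp (Subring.subset_closure (Or.inr ⟨j.1, rfl⟩))
  have hrange : g.range = C := by
    apply le_antisymm
    · rintro _ ⟨z, rfl⟩
      obtain ⟨P, rfl⟩ := blowupAlgebra.eval_surjective x i z
      rw [hgeval']
      exact heval_mem P
    · rw [hCdef, Subring.closure_le]
      rintro z (hz | ⟨j, rfl⟩)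
      · exact ⟨algebraMap S _ ⟨z, hz⟩, hgalg ⟨z, hz⟩⟩
      · exact ⟨blowupAlgebra.frac x i j, hgfrac j⟩
  -- `g` is injective
  have hΘinj : ∀ z, Θ z = 0 → z = 0 := by
    intro z hz
    obtain ⟨⟨a, b⟩, hab⟩ := IsLocalization.surj (Submonoid.powers (x i)) z
    have ha : (a : K) = 0 := by
      have h := congrArg Θ hab
      rw [map_mul, hz, zero_mul, hΘalg] at h
      exact h.symm
    have ha0 : a = 0 := Subtype.ext ha
    rw [ha0, map_zero] at hab
    exact (IsUnit.mul_left_eq_zero (IsLocalization.map_units _ b)).mp hab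
  have hginj : Function.Injective g := by
    intro a b h
    apply Subtype.ext
    have h0 : Θ ((a : Localization.Away (x i)) - b) = 0 := by
      rw [map_sub]
      exact sub_eq_zero.mpr h
    exact sub_eq_zero.mp (hΘinj _ h0)
  -- `e₁ : blowupAlgebra ≃ C`
  have hmem : ∀ b, g b ∈ C := fun b => by rw [← hrange]; exact ⟨b, rfl⟩
  let g' : blowupAlgebra (Ideal.span (Set.range x)) (x i) →+* C := g.codRestrict _ hmem
  have hg' : Function.Bijective g' := by
    refine ⟨fun a b h => hginj (congrArg Subtype.val h), fun z => ?_⟩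
    have hz : (z : K) ∈ g.range := by rw [hrange]; exact z.2
    obtain ⟨b, hb⟩ := hz
    exact ⟨b, Subtype.ext hb⟩
  let e₁ : blowupAlgebra (Ideal.span (Set.range x)) (x i) ≃+* C := RingEquiv.ofBijective g' hg'
  have he₁alg : ∀ s : S, e₁ (algebraMap S (blowupAlgebra (Ideal.span (Set.range x)) (x i)) s) =
      ⟨(s : K), hSC s.2⟩ := fun s => Subtype.ext (hgalg s)
  -- the presentation modulo `x_i`: `S[T] → blowupAlgebra/(x_i)` is onto with kernel `I · S[T]`
  let J : Ideal (blowupAlgebra (Ideal.span (Set.range x)) (x i)) :=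
    Ideal.span {algebraMap S (blowupAlgebra (Ideal.span (Set.range x)) (x i)) (x i)}
  let π : MvPolynomial {j : Fin r // j ≠ i} S →+* blowupAlgebra (Ideal.span (Set.range x)) (x i) ⧸ J :=
    (Ideal.Quotient.mk J).comp (blowupAlgebra.eval x i).toRingHom
  have hπsurj : Function.Surjective π :=
    Ideal.Quotient.mk_surjective.comp (blowupAlgebra.eval_surjective x i)
  have hπker : RingHom.ker π = Ideal.map MvPolynomial.C (Ideal.span (Set.range x)) := by
    change RingHom.ker ((Ideal.Quotient.mk J).comp _) = _
    rw [← RingHom.comap_ker, Ideal.mk_ker]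
    exact blowupAlgebra.comap_eval_span_algebraMap_eq x i hqr
  -- `S[T] → (S/I)[T]` is onto with the same kernel
  let σ : MvPolynomial {j : Fin r // j ≠ i} S →+*
      MvPolynomial {j : Fin r // j ≠ i} (S ⧸ Ideal.span (Set.range x)) :=
    MvPolynomial.map (Ideal.Quotient.mk (Ideal.span (Set.range x)))
  have hσsurj : Function.Surjective σ := MvPolynomial.map_surjective _ Ideal.Quotient.mk_surjective
  have hσker : RingHom.ker σ = Ideal.map MvPolynomial.C (Ideal.span (Set.range x)) := by
    change RingHom.ker (MvPolynomial.map (Ideal.Quotient.mk (Ideal.span (Set.range x)))) = _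
    rw [MvPolynomial.ker_map, Ideal.mk_ker]
  -- hence `ψ' : (S/I)[T] → blowupAlgebra/(x_i)`, a bijection
  let ψ' : MvPolynomial {j : Fin r // j ≠ i} (S ⧸ Ideal.span (Set.range x)) →+*
      blowupAlgebra (Ideal.span (Set.range x)) (x i) ⧸ J :=
    σ.liftOfSurjective hσsurj ⟨π, by rw [hσker, hπker]⟩
  have hψ'σ : ∀ P, ψ' (σ P) = π P := fun P =>
    σ.liftOfSurjective_comp_apply hσsurj ⟨π, by rw [hσker, hπker]⟩ P
  have hψ'bij : Function.Bijective ψ' := by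
    constructor
    · refine (injective_iff_map_eq_zero ψ').mpr fun Q hQ => ?_
      obtain ⟨P, rfl⟩ := hσsurj Q
      rw [hψ'σ] at hQ
      have hP : P ∈ RingHom.ker σ := by rw [hσker, ← hπker]; exact hQ
      exact hP
    · intro z
      obtain ⟨P, rfl⟩ := hπsurj z
      exact ⟨σ P, hψ'σ P⟩
  -- transport along `e₁`
  let J' : Ideal C := Ideal.span {(⟨(x i : K), hSC (x i).2⟩ : C)}
  have hJJ' : J' = J.map (e₁ : blowupAlgebra (Ideal.span (Set.range x)) (x i) →+* C) := by
    change Ideal.span _ = Ideal.map _ (Ideal.span _)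
    rw [Ideal.map_span, Set.image_singleton]
    congr 2
    exact (he₁alg (x i)).symm
  let q : blowupAlgebra (Ideal.span (Set.range x)) (x i) ⧸ J ≃+* C ⧸ J' :=
    Ideal.quotientEquiv J J' e₁ hJJ'
  refine ⟨q.toRingHom.comp ψ', q.bijective.comp hψ'bij, fun s => ?_, fun j => ?_⟩
  · -- constants: `C s̄ ↦ [s/1] ↦ [s]`
    have hσC : σ (MvPolynomial.C s) = MvPolynomial.C (Ideal.Quotient.mk _ s) := MvPolynomial.map_C _ _
    change q (ψ' (MvPolynomial.C (Ideal.Quotient.mk _ s))) = _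
    rw [← hσC, hψ'σ]
    change q (Ideal.Quotient.mk J ((blowupAlgebra.eval x i) (MvPolynomial.C s))) = _
    rw [blowupAlgebra.eval_C, Ideal.quotientEquiv_mk]
    congr 1
    exact he₁alg s
  · -- variables: `T_j ↦ [x_j/x_i ∈ blowupAlgebra] ↦ [x_j/x_i]`
    have hσX : σ (MvPolynomial.X j) = MvPolynomial.X j := MvPolynomial.map_X _ _
    change q (ψ' (MvPolynomial.X j)) = _
    rw [← hσX, hψ'σ]
    change q (Ideal.Quotient.mk J ((blowupAlgebra.eval x i) (MvPolynomial.X j))) = _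
    rw [blowupAlgebra.eval_X, Ideal.quotientEquiv_mk]
    congr 1
    exact Subtype.ext (hgfrac j.1)

/-! ## §2 The chart family is part of a regular system of parameters of `R' = C_{𝔪_O ∩ C}` -/

section Chart

variable {O : ValuationSubring K} {R : Subring K}

/-- The chart ring `R[c_j/c_i : j]` lies in `O` when `c_i` has maximal value among the `c_j`. [folklore] -/
theorem closure_chart_le (hRO : R ≤ O.toSubring) {r : ℕ} (c : Fin r → R) (i : Fin r) (hci : c i ≠ 0)
    (hmax : ∀ j, O.valuation ((c j : R) : K) ≤ O.valuation ((c i : R) : K)) :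
    Subring.closure ((R : Set K) ∪ Set.range fun j => ((c j : R) : K) / ((c i : R) : K)) ≤ O.toSubring := by
  refine Subring.closure_le.mpr ?_
  rintro z (hz | ⟨j, rfl⟩)
  · exact hRO hz
  · have h0 : ((c i : R) : K) ≠ 0 := fun e => hci (Subtype.ext e)
    have hv0 : O.valuation ((c i : R) : K) ≠ 0 := by simpa using h0
    change ((c j : R) : K) / ((c i : R) : K) ∈ O
    rw [← O.valuation_le_one_iff, map_div₀, div_le_one₀ (pos_iff_ne_zero.mpr hv0)]
    exact hmax j

/-- The chart ring is Noetherian (a finitely generated algebra over the Noetherian `R`). [folklore] -/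
theorem isNoetherianRing_closure_chart [IsNoetherianRing R] {r : ℕ} (c : Fin r → R) (i : Fin r) :
    IsNoetherianRing (Subring.closure ((R : Set K) ∪ Set.range fun j => ((c j : R) : K) / ((c i : R) : K))) := by
  classical
  set t : Finset K := Finset.univ.image fun j => ((c j : R) : K) / ((c i : R) : K) with ht
  have hrange : (Set.range fun j => ((c j : R) : K) / ((c i : R) : K)) = (t : Set K) := by
    rw [ht, Finset.coe_image, Finset.coe_univ, Set.image_univ]
  have e : Subring.closure ((R : Set K) ∪ Set.range fun j => ((c j : R) : K) / ((c i : R) : K)) =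
      (Algebra.adjoin R (t : Set K)).toSubring := by
    rw [Algebra.adjoin_eq_ring_closure, hrange]
    congr 1
    ext z
    simp only [Set.mem_union, SetLike.mem_coe, Set.mem_range]
    constructor
    · rintro (hz | hz)
      · exact Or.inl ⟨⟨z, hz⟩, rfl⟩
      · exact Or.inr hz
    · rintro (⟨w, rfl⟩ | hz)
      · exact Or.inl w.2
      · exact Or.inr hz
  rw [e]
  exact isNoetherianRing_of_fg (Subalgebra.fg_adjoin_finset t)

variable [IsRegularLocalRing R]

/-- **The chart family is part of a regular system of parameters of the local blowing up** (the tree's abstract-chart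
theorem `isRsopPart_chartFamily`, de Jong 2.4, instantiated on the closure chart inside `K`). Data: `R ⊆ K` regular local,
dominated by `O` (`a ∈ 𝔪_R ↔ v(a) < 1`); `(c, w)` a regular system of parameters of `R` split as centre part `c : Fin r → R`
and rest `w : Fin l → R`; `c_i ≠ 0` of maximal value among the `c_j`; `C = R[c_j/c_i : j]`, `R' = C_{𝔪_O ∩ C}`; `jJ` an
injective enumeration of indices `j ≠ i` whose fractions `c_j/c_i` lie in the centre of `O`. Then
`(c_i, (c_{jJ k}/c_i)_k, (w_k)_k)` is part of a regular system of parameters of `R'`. [cite: DeJong1996, 2.4]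
[cite: StacksProject, Tag 0BIQ] -/
theorem isRsopPart_chartFamily_closure (hRO : R ≤ O.toSubring)
    (hval : ∀ a : R, a ∈ maximalIdeal R ↔ O.valuation (a : K) < 1)
    {r l : ℕ} (c : Fin r → R) (w : Fin l → R)
    (hz : Ideal.span (Set.range (Fin.append c w)) = maximalIdeal R) (hd : (maximalIdeal R).spanFinrank = r + l)
    (i : Fin r) (hci : c i ≠ 0) (hmax : ∀ j, O.valuation ((c j : R) : K) ≤ O.valuation ((c i : R) : K))
    {a : ℕ} (jJ : Fin a → {j : Fin r // j ≠ i}) (hjJ : Function.Injective jJ)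
    (hJ : ∀ k, O.valuation (((c (jJ k).1 : R) : K) / ((c i : R) : K)) < 1) :
    @IsRsopPart _ _ (isLocalRing_locAtCentre (closure_chart_le hRO c i hci hmax)) _ (chartFamily c i w
      (locAtCentre (Subring.closure ((R : Set K) ∪ Set.range fun j => ((c j : R) : K) / ((c i : R) : K))) O)
      (Subring.inclusion (le_closure_chart R c i))
      (fun j => ⟨((c j : R) : K) / ((c i : R) : K), div_mem_closure_chart R c i j⟩) jJ) := by
  classical
  set C := Subring.closure ((R : Set K) ∪ Set.range fun j => ((c j : R) : K) / ((c i : R) : K)) with hCdef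
  have hRC : R ≤ C := le_closure_chart R c i
  have hCO : C ≤ O.toSubring := closure_chart_le hRO c i hci hmax
  haveI : IsNoetherianRing C := isNoetherianRing_closure_chart c i
  haveI := isLocalization_locAtCentre hCO
  haveI : IsLocalRing (locAtCentre C O) := isLocalRing_locAtCentre hCO
  have h0 : ((c i : R) : K) ≠ 0 := fun e => hci (Subtype.ext e)
  -- `c` is quasi-regular (part of the regular system of parameters `(c, w)`)
  have hqr : IsQuasiRegular c := by
    have hq := isQuasiRegular_rsop_comp hd (Fin.append c w) hz (Fin.castAdd l) (Fin.castAdd_injective _ _)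
    have hcomp : Fin.append c w ∘ Fin.castAdd l = c := funext fun j => by simp
    rwa [hcomp] at hq
  -- the chart quotient `C/(c_i) ≅ (R/P)[T_j : j ≠ i]`, constants and variables tracked
  obtain ⟨ψ, hψ, hψC, hψX⟩ := closure_chartQuotient_X R c hqr i hci
  -- `c_i` is a non-zero-divisor of the domain `C`
  have hnzd : Subring.inclusion hRC (c i) ∈ nonZeroDivisors C := by
    refine mem_nonZeroDivisors_of_ne_zero fun e => h0 ?_
    exact congrArg Subtype.val e
  -- the centre of `O` on `C` lies over `𝔪_R`
  have h𝔓 : (subringCentre C O hCO).comap (Subring.inclusion hRC) = maximalIdeal R := by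
    ext a
    rw [Ideal.mem_comap, mem_subringCentre_iff, hval]
    rfl
  exact isRsopPart_chartFamily c i w hz hd (locAtCentre C O) (Subring.inclusion hRC)
    (fun j => ⟨((c j : R) : K) / ((c i : R) : K), div_mem_closure_chart R c i j⟩) hnzd
    (RingEquiv.ofBijective ψ hψ) (fun s => hψC s) (fun j => hψX j) (subringCentre C O hCO) h𝔓 jJ hjJ
    (fun k => (mem_subringCentre_iff hCO _).mpr (hJ k))

/-- **Two fractions `c_{j₁}/c_i, c_{j₂}/c_i` of the centre's regular parameters which lie in the centre of `O` are part of a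
regular system of parameters of the local blowing up `R' = (R[c_j/c_i])_{𝔪_O ∩ R[c_j/c_i]}`** — the form the critical-surface
thread consumes (`c_{j₁} = e₁`, `c_{j₂} = e₂` the transported Jacobian pair, `c_i` the exceptional parameter up to a unit).
[cite: DeJong1996, 2.4] [cite: StacksProject, Tag 0BIQ] -/
theorem isRsopPart_pair_chart (hRO : R ≤ O.toSubring)
    (hval : ∀ a : R, a ∈ maximalIdeal R ↔ O.valuation (a : K) < 1)
    {r : ℕ} (c : Fin r → R) (hc : IsRsopPart c)
    (i : Fin r) (hci : c i ≠ 0) (hmax : ∀ j, O.valuation ((c j : R) : K) ≤ O.valuation ((c i : R) : K))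
    (j₁ j₂ : Fin r) (hj₁ : j₁ ≠ i) (hj₂ : j₂ ≠ i) (hj : j₁ ≠ j₂)
    (hv₁ : O.valuation (((c j₁ : R) : K) / ((c i : R) : K)) < 1)
    (hv₂ : O.valuation (((c j₂ : R) : K) / ((c i : R) : K)) < 1)
    (R' : Subring K) [IsLocalRing R']
    (hR' : R' = locAtCentre (Subring.closure ((R : Set K) ∪ Set.range fun j => ((c j : R) : K) / ((c i : R) : K))) O)
    (h₁ : ((c j₁ : R) : K) / ((c i : R) : K) ∈ R') (h₂ : ((c j₂ : R) : K) / ((c i : R) : K) ∈ R') :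
    IsRsopPart ![(⟨((c j₁ : R) : K) / ((c i : R) : K), h₁⟩ : R'), ⟨((c j₂ : R) : K) / ((c i : R) : K), h₂⟩] := by
  classical
  subst hR'
  set C := Subring.closure ((R : Set K) ∪ Set.range fun j => ((c j : R) : K) / ((c i : R) : K)) with hCdef
  -- complete `c` to a regular system of parameters `(c, w)`
  obtain ⟨l, z, hd, hz, hzc⟩ := hc.exists_rsop
  set w : Fin l → R := z ∘ Fin.natAdd r with hw
  have hzcw : Fin.append c w = z := by
    ext k
    induction k using Fin.addCases with
    | left j => rw [Fin.append_left, hzc]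
    | right j => rw [Fin.append_right]; rfl
  have hz' : Ideal.span (Set.range (Fin.append c w)) = maximalIdeal R := by rw [hzcw]; exact hz
  -- the enumeration `jJ = (j₁, j₂)`
  let jJ : Fin 2 → {j : Fin r // j ≠ i} := ![⟨j₁, hj₁⟩, ⟨j₂, hj₂⟩]
  have hjJ : Function.Injective jJ := by
    intro a b hab
    fin_cases a <;> fin_cases b
    · rfl
    · exact absurd (congrArg (fun t : {j : Fin r // j ≠ i} => t.1) hab) hj
    · exact absurd (congrArg (fun t : {j : Fin r // j ≠ i} => t.1) hab).symm hj
    · rfl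
  have hJ : ∀ k, O.valuation (((c (jJ k).1 : R) : K) / ((c i : R) : K)) < 1 := by
    intro k
    fin_cases k
    · exact hv₁
    · exact hv₂
  have hfam := isRsopPart_chartFamily_closure hRO hval c w hz' hd i hci hmax jJ hjJ hJ
  -- extract positions `1, 2` of the chart family `(c_i, c_{j₁}/c_i, c_{j₂}/c_i, w…)`
  let ι : Fin 2 → Fin (2 + l + 1) := fun k => ⟨k.1 + 1, by omega⟩
  have hι : Function.Injective ι := fun a b hab => by
    apply Fin.ext
    have := congrArg Fin.val hab
    simp only [ι] at this
    omega
  have h := hfam.comp ι hι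
  convert h using 2
  funext k
  fin_cases k
  · simp only [Function.comp_apply, ι]
    rw [show (⟨0 + 1, by omega⟩ : Fin (2 + l + 1)) = Fin.succ ⟨0, by omega⟩ from rfl, chartFamily, Fin.cons_succ,
      show (⟨0, by omega⟩ : Fin (2 + l)) = Fin.castAdd l (0 : Fin 2) from rfl, Fin.append_left]
    rfl
  · simp only [Function.comp_apply, ι]
    rw [show (⟨1 + 1, by omega⟩ : Fin (2 + l + 1)) = Fin.succ ⟨1, by omega⟩ from rfl, chartFamily, Fin.cons_succ,
      show (⟨1, by omega⟩ : Fin (2 + l)) = Fin.castAdd l (1 : Fin 2) from rfl, Fin.append_left]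
    rfl

end Chart

end Summit.ResolutionOfSingularities.ResolutionOfSingularities.Theorems.SwitchingDichotomy.ChartRsop

end
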